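import Literature.AlgebraicGeometry.Dimension.SmoothRelativeDimensionOfClosedPoints
import Literature.AlgebraicGeometry.Resolution.SmoothStalksRegular
import Literature.AlgebraicGeometry.ModuliOfAbelianVarieties.SiegelFineModuliSchemeExists
import Literature.AlgebraicGeometry.Motives.BaseChange
import Summits.HodgeConjecture.CorCM.HypDel.M1primeOfFU
import HarnessLib
import Literature.AlgebraicGeometry.ModuliOfAbelianVarieties.SiegelFineModuliFibreTriples
import Literature.AlgebraicGeometry.Motives.ComplexPointsManifold
import Literature.AlgebraicGeometry.Motives.UniversalHypersurfaceQuasiProjective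
import Literature.Topology.Euclidean.InvarianceOfDimension
import Summits.HodgeConjecture.HodgeConjecture.Theorems.SiegelClassifyEqOfAdmissible
import Summits.HodgeConjecture.HodgeConjecture.Theorems.UHeadGlueClassMap
import Summits.HodgeConjecture.HodgeConjecture.Theorems.SiegelUniversalFamilyHodgeFrames
import Mathlib.Data.Sym.Card
import Literature.AlgebraicGeometry.ModuliOfAbelianVarieties.SiegelModuliComplexUniformisation
import Literature.NumberTheory.ModularForms.SiegelSymplecticVolume
import Literature.Topology.Euclidean.DimensionOfSmoothBijection
import Literature.AlgebraicGeometry.Limits.RelativeDimensionFieldDescent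
import Literature.AlgebraicGeometry.ModuliOfAbelianVarieties.SiegelFineModuliSchemeRelDim
import Mathlib.AlgebraicGeometry.AlgClosed.Basic
import Summits.HodgeConjecture.HodgeConjecture.Theorems.UOfF                        -- ★ p737802: `UOfF.U_of_relDim_F (hF′) : (U)`
import Summits.HodgeConjecture.HodgeConjecture.Theorems.HCCMUnconditionalHDelOfFU   -- ★ (v4): `HDel_of_F_U (hF) (hU) : HCCMUnconditional.HDel`
import Summits.HodgeConjecture.HodgeConjecture.Theorems.UeP4OfFPiece              -- ★ lane T (11): `UeP4OfFPiece.ue_P4_piece_of_F (hF) : UHead.Ue_P4_piece` (v1.2)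
import Literature.AlgebraicGeometry.ModuliOfAbelianVarieties.SiegelModuliThickPoints   -- ★ p745366: `EquidimOfF.IsThickAtWith` / `IsThickAt` (v1.3)
import Summits.HodgeConjecture.HodgeConjecture.Theorems.EquidimThickIffLe         -- ★ p746146 (E1): `le_of_isThickAt`, `stub_le'`, `isThickAtWith_of_isAdmissibleAt` (v1.3)
import Summits.HodgeConjecture.HodgeConjecture.Theorems.EquidimNoThinPiece        -- (E3): `noThinPiece_of_quotientMaps (hF) (hQuot)` over ★ socket (A) + ★ (T2) (v1.3)
import Summits.HodgeConjecture.HodgeConjecture.Theorems.EquidimNoThinPieceOpen    -- (E-e): `noThinPiece_of_quotientMaps₃ (hF) (hQuot₃ := socket (B) v8)` over (E-c) `…_odd_open` (v1.4a)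
import Summits.HodgeConjecture.HodgeConjecture.Theorems.EquidimHeckeQuotientFamily -- (O-y): THE socket-(B) theorem `socketQuotientMaps_of_quotientTriples (…) (hQ)` = v8 text (v1.4a)
import Summits.HodgeConjecture.HodgeConjecture.Theorems.EquidimHExtOfPiece          -- COMPOSER (B-p04 (g18)): `hExt_of_piece` — the (ii)-chain package at the piece; v1.5: `stub_quotientTriples₈` REAL

/-!
# E-ROAD SKELETON v1.5 — REGISTERED SHAPE, PIECE CURRENCY (B-plan1 (g15), E-road skeleton pen; D-0175 (A4)(i), s167 (4), s173 (1), s191, s199)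
# `(F) ⇒ (F′)` and `(F) ⇒ hDel` REAL — SORRY-FREE: `stub_quotientTriples₈` («quotient triples over the thick open piece») REAL over the COMPOSER
# (v1.5: `stub_quotientTriples₈` REAL over ★ `EquidimHExtOfPiece.hExt_of_piece` + ★ `EquidimHeckeQuotientTriplesOfPiece.socketQuotientTriples_of_ext`;
#  v1.4a: socket (B) `stub_quotientMaps₈` REAL over the (O-y) theorem; v1.3: `stub_noThinPiece` REAL over (E3); v1.2: `stub_P4piece` REAL BY IMPORT)

v1.5 DELTA over v1.4a 6a9eea2363fb3adf (tree `Cruxes/HDel/Lines/EquidimOfF.lean` commit 86033b1e78ea) — THE LAST SORRY CLOSES: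
(a) one new import — the COMPOSER `Theorems.EquidimHExtOfPiece` (B-p04 (g18); `hExt_of_piece` = the `hExt` package of ★ p753187
`EquidimHeckeQuotientTriplesOfPiece.socketQuotientTriples_of_ext` for the universal family pulled back to the thick open piece, conjunct by
conjunct over ★ files of the B fan: `hcov` ★ p751782 · `hcov′` ★ p753433 ((B5) road E) · group law / smoothness / connectedness of the
quotients ★ · `K′ := λ′_*K`, `hfree′` ★ p753255 · `hlam` ★ `PolarizationLamTranslationInvariance` · isotropy `hiso` ★ p754396 (H-iso-1) +
★ p754461 (H-iso-2, Kummer bridge) + ★ p754804 (H-iso-3/4) ⇒ `Φ` ★ p745266/p754158 · D6 `h4` ★ p753888 `universal_poincareQuotRigid_of_level`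
(hloc ★ p753403/p753564, hStab ★ p753594/p753946, hdesc ★ p753817, (DET) ★ p753232/p753588/p753756) · `polB`/`hpolB` ★ p752162/p753977 ·
`htype` ★ p755051 (β)); (b) `theorem stub_quotientTriples₈ : SocketQuotientTriples₈` REAL := `socketQuotientTriples_of_ext … (hExt_of_piece …)`
(the QT plug-test one-liner of B-p21 (g14) / B-p04 (g18)); nothing else changes (socket texts `SocketQuotientMaps₈` / `SocketQuotientTriples₈`
byte-identical to v1.4a).  Sorries 1 → 0.  KERNEL DATUM OF RECORD (v1.5): rc 0 / errors [] / warnings [] / sorries 0; `--axioms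
…EquidimOfF.HDel_of_E` = {propext, Classical.choice, Quot.sound}.  hDel binder of record = {`stub_F′`} (registry `F1ExtHodgeType.lean` v5.2
6c02d23f) until the director words registry v5.3; NOT registered (no `skeleton check`); written on the director's word.

v1.4a DELTA over v1.3 4c5575a78a74f113 (tree `Cruxes/HDel/Lines/EquidimOfF.lean` commit 41382e2e45a8) — THE SORRY MOVES ONE LEVEL DOWN:
(a) two new imports — (E-e) `Theorems.EquidimNoThinPieceOpen` (`noThinPiece_of_quotientMaps₃`, consumer of socket (B) TEXT v8 over (E-c)
`Theorems.EquidimSocketThickLinkedLiftOpen.thickLinkedLift_heckeLinkedDeg_odd_open` = socket (A) re-exported WITH its open-immersion witness,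
its similitude degree `N′/N`, `Odd (N′/N)` and `Nat.Coprime (N′/N) (∏ δᵢ)`) and the (O-y) assembler `Theorems.EquidimHeckeQuotientFamily`
(`socketQuotientMaps_of_quotientTriples (…socket binders…) (hQ)`: socket (B) from QUOTIENT TRIPLES over the piece, via ★ p748400 `hfam`
⇒ ★ p745772 `∃ Φ`); (b) the file-local socket text is now `def SocketQuotientMaps₈ : Prop` = SOCKET (B) TEXT v8 (bytes of record
`B-plan/F-census/SOCKET-B-v8.text.B-plan1g15.lean` 50c62588c6da0372) = v6 with EXACTLY three changes: `[IsOpenImmersion ι'.left]` after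
the `ι'` binder (★ `quotientBy` needs a separated base; the thick piece IS an open piece of `𝓜′_ℂ`), `HeckeLinked … →` ↦
`HeckeLinkedDeg 𝓜 𝓜' r' (ι′ s′) x (N' / N) →` (★ p750692 `SiegelHeckeLinkDegree`: the link predicate recording the similitude factor),
and `Nat.Coprime (N' / N) (∏ i, δ i) →` after `Odd (N' / N) →` (the ★ `hasType` road wants kernel orders coprime to `∏ δᵢ`; free on the
(A) side: a prime `ℓ > N·∏δᵢ`); the v6 `def SocketQuotientMaps` (v1.3 :696–:717) and its `sorry`d `stub_quotientMaps` (:718–:719) are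
DELETED; (c) NEW file-local `def SocketQuotientTriples₈ : Prop` = the socket binders through `Nat.Coprime …` followed by the (O-y) head's
`hQ` hypothesis VERBATIM (B-p21 (g14) ed.3 d5db76471c645e8b :210–:238, names qualified for this file's opens): «for every `ℚ`-descent `ι′ℚ`
of the piece and every integral `γ` realising the link, the pulled-back universal family `ι′ℚ^* 𝓜′.univ` has a QUOTIENT TRIPLE
`(Q, ψ)` of level `N`, type `δ`, kernel cut out by `γ · r′ mod N′` on the level sections, and `ψ^* λ_Q`-compatibility `IsLambdaOfAt`»,
with `theorem stub_quotientTriples₈ : SocketQuotientTriples₈ := by sorry` — THE ONE REMAINING SORRY (pure algebraic geometry of abelian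
schemes over the piece: the (ii)-chain `Q := (A′/K, λ_B, σ_B)` — D6 `h4` + (cov-3) + `hasType` ★ p751190 + (Q-dim) + level/symplectic;
no period map, no complex analysis, no moduli interpretation left in the stub); (d) `theorem stub_quotientMaps₈ : SocketQuotientMaps₈`
REAL := `EquidimHeckeQuotientFamily.socketQuotientMaps_of_quotientTriples … (stub_quotientTriples₈ …)`; (e) `stub_noThinPiece` REAL :=
(E-e) `EquidimNoThinPieceOpen.noThinPiece_of_quotientMaps₃ g hF stub_quotientMaps₈ …`.  Sorries 1 → 1 (moved down); kernel datum of
record: rc 0 / errors [] / warnings = EXACTLY 1 «declaration uses sorry» (`stub_quotientTriples₈`), `--axioms …EquidimOfF.HDel_of_E` =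
{propext, sorryAx, Classical.choice, Quot.sound}.  hDel binder of record UNCHANGED = {`stub_F′`} (registry `F1ExtHodgeType.lean` v5.2
6c02d23f); NOT registered (no `skeleton check`); written on the director's word.  v1.5 = `stub_quotientTriples₈` REAL (`hQ_of_piece`).

v1.3 DELTA over v1.2 4c58f6c441190d1d (tree `Cruxes/HDel/Lines/EquidimOfF.lean` commit a339b01acc8c) — director s191 shape (a)–(d),
bytes = B-p01 (g13) prep `EquidimOfF.v1.3.prep.B-p01g13.lean` ea8e0eaaacaef94d except this docstring: (a) three ★ imports —
p745366 `SiegelModuliThickPoints` (`EquidimOfF.IsThickAtWith` / `IsThickAt`, germ form), p746146 (E1) `Theorems.EquidimThickIffLe`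
(`le_of_isThickAt`, `stub_le'`-side glue), p747670 (E3) ed.2 `Theorems.EquidimNoThinPiece` — the v1.2 file-local `IsThickAt` /
`le_of_isThickAt` are now BY IMPORT (§1 of the thick block); (b) nothing else of v1.2 :1–689 changes; (c) the file-local
statement-valued `def SocketQuotientMaps : Prop` = SOCKETS v6 (B) text of record (B-plan1 (g14) 21:50:29Z / 21:52:55Z: v5 binders
verbatim incl. `(_ : IsThickAtWith hδ' 𝓜' ι' d'' s' r')`, then `HeckeLinked … → Odd (N' / N) → ∃ Φ …`; socket (A) v6 is CLOSED in the
tree: ★ p747023 `EquidimSocketThickLinkedLift.thickLinkedLift_heckeLinked_odd`) + `theorem stub_quotientMaps : SocketQuotientMaps :=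
by sorry`; (d) `theorem stub_noThinPiece : NoThinPiece` REAL := (E3) `EquidimNoThinPiece.noThinPiece_of_quotientMaps₂ g hF
stub_quotientMaps …`.  Sorries 1 → 1 (the one sorry moves one level down, from the residual `NoThinPiece` to socket (B));
hDel binder of record UNCHANGED = {`stub_F′`} (registry `F1ExtHodgeType.lean` v5.2 6c02d23f); books effect 0; NOT registered
(no `skeleton check`); v1.3 is the last E-road write until socket (B) closes (its assembler: ONE `PolarizedAbelianSchemeWithLevel`
for `B := A′/K` over the thick piece — SOCKETS-F v0.5 be6576be).

v1.2 DELTA over v1.1 048d3365459f7535 (tree `Cruxes/HDel/Lines/EquidimOfF.lean` commit d5323b6487ac): ONE new import (★ lane-T head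
`Summits.HodgeConjecture.HodgeConjecture.Theorems.UeP4OfFPiece`) and `theorem stub_P4piece (hF) : UHead.Ue_P4_piece :=
UeP4OfFPiece.ue_P4_piece_of_F hF` (REAL); every other byte of v1.1 unchanged except this docstring.  Sorries = 1.

WHAT THIS FILE IS.  The v1-of-record skeleton `EQUIDIM-skeleton.v1.B-plan1g13.lean` 73fa2304 had the two sorries
`stub_le` / `stub_ge` at `ℂ`-sections.  B-p01 (g13)'s piece reduction (`EquidimPieces` c8dc150a, `StubLePrime` 83c79871,
`StubGePrime` 2667e516, composed `ERoad.cert.v1.B-p01g13.lean` 8ad6ef03) makes both REAL modulo two honest sockets; this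
edition RE-CUTS the registered shape accordingly (decision B-plan1 (g13) 18:23:42Z/18:25:29Z «piece currency»):

* lines 1–20 and 66–689 = `B-provers/B-p01/ERoad.cert.v1.B-p01g13.lean` sha16 8ad6ef035d995e08 lines 1–20 / 21–644 VERBATIM
  (generic `Dimension` layer · carriers `MC`/`IsSection`/`pt`/`tdim` (= v1 :60–:78) · `tdim_eq_of_openPiece`,
  `exists_openPiece_of_section`, `stub_le_of_openPieces`, `stub_ge_of_openPieces` · the P4-piece socket TEXT
  `UHead.Ue_P4_piece` (= B-p03 (g14) `P4piece-text.v1.lean` 0225915a :43–:75 verbatim; G-AN1) · `stub_le'` REAL over it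
  (★ Brouwer `finrank_le_of_injOn_of_isOpen` + ★ P6 `classifyingMap_eq_of_isAdmissibleAt`) · `IsThickAt`, `le_of_isThickAt`
  REAL over ★ (O4) `finrank_complex_le_of_differentiableOn_of_nonempty_interior` · `StubThick`, `stub_le_of_P4piece`,
  `stub_ge_of_thick`, `relDim_of_F_of_P4piece_of_thick`);
* §REG (this seat, lines 690–end) = the REGISTERED SHAPE:
  - `NoThinPiece : Prop` — THE WEAKEST residual the glue consumes: «given (F) and the P4-piece socket, every smooth open piece
    `ι : S′ ⟶ 𝓜_ℂ` of pure relative dimension `d` that carries a `ℂ`-point has `g(g+1)/2 ≤ d`» (no THIN piece).  It is what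
    EVERY road outputs: realisation / KS-surjective (XL; B-p14 (g14) census 3674bacc) ⇒ `StubThick` (∀-form) ⇒ `NoThinPiece`
    (`noThinPiece_of_thick`, REAL here); Hecke-link (L–XL; B-p14 v3 53f8d32c §4) ⇒ «every piece has a point of local
    dimension `g(g+1)/2`» ⇒ `NoThinPiece` directly; properness (XL) ⇒ `StubThick`.  TRUE iff EQUIDIM given G-AN1 (B-p01 (g13)
    18:28:04Z: NOT a consequence of the ★ facts alone — a thin clopen piece with closed null Γ-stable period set is consistent
    with everything ★; hence an honest XL residual, not glue).
  - `theorem stub_P4piece (hF : (F)) : UHead.Ue_P4_piece` — REAL since v1.2 (was `by sorry` in v1.1) — G-AN1 given (F); its signature IS the type of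
    B-p03 (g14)'s HOME head `UHead.Ue_P4_piece_holds_modF (hF : lan2013_siegelFineModuliScheme) : Ue_P4_piece`, KERNEL-GREEN BY
    PASTE 18:41:32Z (`Ue-P4piece-v1.bypaste.B-p03g14.lean` 2e8f61a6, 3788 l., rc 0 / sorries 0 / trio; twin B-p13 (g16) ✓) —
    CLOSED IN THE TREE since v1.2 by the ONE term `UeP4OfFPiece.ue_P4_piece_of_F hF` over the eleven ★ lane-T piece files
    (p739669 · p740018 · p740495 · p740210 · p740249 · p740729 · p740807 · p741150 · p741342 · p741224 · (11) `UeP4OfFPiece`; count-neutral capital).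
  - `theorem stub_noThinPiece : NoThinPiece` — REAL since v1.3 over (E3) ed.2 ★ p747670 `noThinPiece_of_quotientMaps₂` modulo the
    ONE stub `theorem stub_quotientMaps : SocketQuotientMaps := by sorry` (socket (B) of the Hecke link, SOCKETS v6 text, file-local
    `def`); v1.1/v1.2: `by sorry` — THE hardest stub (XL), after G-AN1 the ONE open residual of «EQUIDIM by proof»;
    v1.4a: over (E-e) `EquidimNoThinPieceOpen.noThinPiece_of_quotientMaps₃` and `stub_quotientMaps₈ : SocketQuotientMaps₈` (socket (B)
    TEXT v8) := the (O-y) assembler's theorem BY NAME, modulo the ONE stub `theorem stub_quotientTriples₈ : SocketQuotientTriples₈ :=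
    by sorry` (quotient triples over the thick open piece — the (ii)-chain; the open residual of «EQUIDIM by proof» since v1.4a).
  - REAL: `stub_ge_of_noThinPiece`; the v1 texts `stub_le` / `stub_ge` VERBATIM (v1 :111–:125 binders and goals) now as
    THEOREMS over the two stubs; `tdim_eq_of_stubs`, `smoothOfRelativeDimension_of_F`, head **`relDim_of_F (hF : (F)) : (F′)`**
    (v1 head text verbatim, (F′) = ★ p737414 `lan2013_siegelFineModuliScheme_relDim` BY IMPORT — v1 §4's pasted copy is GONE);
    and the informative junction **`HDel_of_E (hF : (F)) : HCCMUnconditional.HDel`** := ★ `HDel_of_F_U hF (UOfF.U_of_relDim_F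
    (relDim_of_F hF))` — «(F) as PRINTED + {G-AN1, NoThinPiece} ⇒ hDel», i.e. exactly D-0175 (A4)(i)'s content.
EXPECTED KERNEL DATUM (v1.5): rc 0 / errors [] / warnings [] / sorries 0; `--axioms …EquidimOfF.HDel_of_E` / `…relDim_of_F` /
`…stub_quotientTriples₈` = {propext, Classical.choice, Quot.sound} — NO sorryAx anywhere.
FORMER KERNEL DATUM (v1.4a): rc 0 / errors [] / warnings = EXACTLY 1 «declaration uses sorry» (`stub_quotientTriples₈`) / sorries 1;
`--axioms …EquidimOfF.HDel_of_E` = {propext, sorryAx, Classical.choice, Quot.sound} (sorryAx from `stub_quotientTriples₈` only).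
FORMER KERNEL DATUM (v1.3): rc 0 / errors [] / warnings = EXACTLY 1 «declaration uses sorry» (`stub_quotientMaps`) /
sorries 1; `--axioms …EquidimOfF.relDim_of_F` / `…stub_noThinPiece` / `…HDel_of_E` = {propext, Classical.choice, Quot.sound, sorryAx}
with sorryAx from exactly that one; `--axioms …EquidimOfF.stub_P4piece` ⊆ trio; `--axioms …EquidimOfF.noThinPiece_of_thick` /
`…stub_ge_of_noThinPiece` / `…relDim_of_F_of_P4piece_of_thick` ⊆ trio.  (v1.2 datum: the same with `stub_noThinPiece` as the sorry.)
REGISTRATION: NOT registered on stmt-HodgeConjecture-24835 (that item's skeleton of record is the registry v5.2 6c02d23f, binder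
hDel = {stub_F′}); publication as an UNREGISTERED workfile `Cruxes/HDel/Lines/EquidimOfF.lean` (precedent: 24833
`rogawski_multone.lean`) waits for the director's word.  HC_CM is proved only modulo the 7 printed citations until rung 0 closes.
-/

/-!
# E-road `stub_le` / `stub_ge` in PIECE CURRENCY — the Zariski tangent dimension of `𝓜_ℂ` at a `ℂ`-section equals the
# relative dimension of ANY smooth open piece through it (B-p01 (g13); skeleton v1 73fa2304 `EquidimOfF`)

HOME probe (no `sorry`; REAL glue over ★ only).  Generic layer (namespace `Literature.AlgebraicGeometry.Dimension`):
for `f : X ⟶ Spec K` smooth and an open immersion `ι : S' ⟶ X` with `ι ≫ f` smooth of relative dimension `d`, the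
cotangent space of `X` at the image of a CLOSED point of `S'` has dimension `d` (★ Stacks 056S regularity of smooth stalks
`Resolution.isRegularLocalRing_stalk_of_smooth_of_field` + stalk iso of the open immersion + ★ A-p14 (g10)
`ringKrullDim_stalk_eq_of_smoothOfRelativeDimension_of_isClosed`); every point has SOME such piece
(★ `Motives.exists_opens_smoothOfRelativeDimension_of_smooth`).  Siegel layer (namespace
`Literature.AlgebraicGeometry.ModuliOfAbelianVarieties.EquidimOfF`, carriers `MC`/`IsSection`/`pt`/`tdim` PASTED
token-identically from skeleton v1 :60–:78): `tdim 𝓜 (pt 𝓜 p) = d` for any open piece of pure dimension `d` through the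
section `p`, hence `stub_le` ⟸ «every smooth open piece of `𝓜_ℂ` with a `ℂ`-point has relative dimension ≤ g(g+1)/2» and
`stub_ge` ⟸ «… ≥ …».  HC_CM is proved only modulo the 7 printed citations until rung 0 closes.
-/

noncomputable section

universe u

open CategoryTheory CategoryTheory.Limits AlgebraicGeometry TopologicalSpace IsLocalRing

namespace Literature.AlgebraicGeometry.Dimension

variable {K : Type u} [Field K] {X S' : Scheme.{u}} (f : X ⟶ Spec (CommRingCat.of K))

/-- **A `K`-rational point of a `K`-scheme is closed** (it is a section of `X → Spec K`, hence a closed immersion;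
Mathlib `isClosedImmersion_of_comp_eq_id`). [folklore] -/
theorem isClosed_singleton_base_of_comp_eq_id (q : Spec (CommRingCat.of K) ⟶ X) (hq : q ≫ f = 𝟙 _) :
    IsClosed ({q.base (closedPoint K)} : Set X) := by
  haveI : IsClosedImmersion q := isClosedImmersion_of_comp_eq_id f q hq
  have hr : Set.range q.base = {q.base (closedPoint K)} := by
    haveI : Unique ↥(Spec (CommRingCat.of K)) := inferInstanceAs (Unique (PrimeSpectrum K))
    rw [Set.range_unique]
    exact congrArg (fun x ↦ ({q.base x} : Set X)) (Subsingleton.elim _ _)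
  rw [← hr]
  exact q.isClosedEmbedding.isClosed_range

/-- **Every point of a smooth `K`-scheme lies in an open piece smooth of SOME relative dimension** (the open subscheme
form of ★ `Motives.exists_opens_smoothOfRelativeDimension_of_smooth`). [cite: GortzWedhorn2020, Prop. 6.15 (1)] -/
theorem exists_opens_smoothOfRelativeDimension [Smooth f] (x : X) :
    ∃ (V : X.Opens) (d : ℕ), x ∈ V ∧ SmoothOfRelativeDimension d (V.ι ≫ f) :=
  Literature.AlgebraicGeometry.Motives.exists_opens_smoothOfRelativeDimension_of_smooth f x

end Literature.AlgebraicGeometry.Dimension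

namespace Literature.AlgebraicGeometry.ModuliOfAbelianVarieties

open Literature.AlgebraicGeometry.Motives (SchemeOver)
open Literature.AlgebraicGeometry.HodgeTheory (IsQuasiProjectiveOver)

namespace EquidimOfF

variable {g N : ℕ} {δ : Fin g → ℕ}

/-! ## §0 Carriers — PASTED token-identically from skeleton v1 73fa2304 :60–:78 -/

/-- The complex fibre `𝓜_ℂ = 𝓜.M ⊗_ℚ ℂ` (★ `Motives.baseChangeHom (algebraMap ℚ ℂ)`; = `(Motives.baseChange ℚ ℂ).obj 𝓜.M`
by `rfl`, the form P5 consumes). -/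
abbrev MC (𝓜 : SiegelFineModuliScheme g N δ) : SchemeOver ℂ :=
  (Literature.AlgebraicGeometry.Motives.baseChangeHom (algebraMap ℚ ℂ)).obj 𝓜.M

theorem MC_eq (𝓜 : SiegelFineModuliScheme g N δ) :
    MC 𝓜 = (Literature.AlgebraicGeometry.Motives.baseChange ℚ ℂ).obj 𝓜.M := rfl

/-- A `ℂ`-SECTION of the complex fibre: a `ℂ`-point `p : Spec ℂ → 𝓜_ℂ` over `Spec ℂ`. -/
def IsSection (𝓜 : SiegelFineModuliScheme g N δ) (p : Spec (CommRingCat.of ℂ) ⟶ (MC 𝓜).left) : Prop :=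
  p ≫ (MC 𝓜).hom = 𝟙 _

/-- The point of `𝓜_ℂ` under a section. -/
abbrev pt (𝓜 : SiegelFineModuliScheme g N δ) (p : Spec (CommRingCat.of ℂ) ⟶ (MC 𝓜).left) : (MC 𝓜).left :=
  p.base (closedPoint ℂ)

/-- `dim_{κ(x)} 𝔪_x/𝔪_x²` — the Zariski (co)tangent dimension of `𝓜_ℂ` at `x`. -/
abbrev tdim (𝓜 : SiegelFineModuliScheme g N δ) (x : (MC 𝓜).left) : ℕ :=
  Module.finrank (ResidueField ((MC 𝓜).left.presheaf.stalk x)) (CotangentSpace ((MC 𝓜).left.presheaf.stalk x))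

/-! ## §1 REAL (as in skeleton v1 §1): (F) ⇒ `𝓜_ℂ` smooth -/

theorem smooth_of_F (hF : lan2013_siegelFineModuliScheme) (hg : 0 < g) (hδ : IsPolarizationType δ) (hN : 3 ≤ N)
    (𝓜 : SiegelFineModuliScheme g N δ) : Smooth 𝓜.M.hom := by
  obtain ⟨𝓜₀, hs, -, -⟩ := hF g N δ hg hδ hN
  let e : 𝓜₀.M ≅ 𝓜.M := SiegelFineModuliScheme.isoOfClassify 𝓜₀ 𝓜
  haveI : IsIso e.inv.left := by
    change IsIso ((Over.forget _).map e.inv)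
    infer_instance
  haveI : Smooth 𝓜₀.M.hom := hs
  have h2 : Smooth (e.inv.left ≫ 𝓜₀.M.hom) := inferInstance
  rwa [Over.w e.inv] at h2

theorem smooth_MC_of_F (hF : lan2013_siegelFineModuliScheme) (hg : 0 < g) (hδ : IsPolarizationType δ) (hN : 3 ≤ N)
    (𝓜 : SiegelFineModuliScheme g N δ) : Smooth (MC 𝓜).hom := by
  rw [Literature.AlgebraicGeometry.Motives.baseChangeHom_obj_hom]
  exact MorphismProperty.pullback_snd (P := @Smooth) _ _ (smooth_of_F hF hg hδ hN 𝓜)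

/-! ## §2 PIECE CURRENCY (REAL): the tangent count at a section equals the relative dimension of ANY smooth open piece
through it; reductions of `stub_le` / `stub_ge` to statements about ONE natural number per piece -/

/-- **`tdim` at a `ℂ`-section equals the relative dimension of any open piece of pure dimension through it**: for an open
immersion `ι : S' ⟶ 𝓜_ℂ` over `ℂ` with `S' → Spec ℂ` smooth of relative dimension `d` and a lift `q` of the section `p`
through `ι`, `tdim 𝓜 (pt 𝓜 p) = d`. [cite: GortzWedhorn2020, Thm. 6.28 (vi)] [cite: StacksProject, Tag 056S] -/
theorem tdim_eq_of_openPiece (𝓜 : SiegelFineModuliScheme g N δ) (hS : Smooth (MC 𝓜).hom)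
    {S' : SchemeOver ℂ} (ι : S' ⟶ MC 𝓜) [IsOpenImmersion ι.left] (d : ℕ) [hd : SmoothOfRelativeDimension d S'.hom]
    (p : Spec (CommRingCat.of ℂ) ⟶ (MC 𝓜).left) (hp : IsSection 𝓜 p)
    (q : Spec (CommRingCat.of ℂ) ⟶ S'.left) (hq : q ≫ ι.left = p) :
    tdim 𝓜 (pt 𝓜 p) = d := by
  haveI : Smooth (MC 𝓜).hom := hS
  haveI : SmoothOfRelativeDimension d (ι.left ≫ (MC 𝓜).hom) := by rw [Over.w ι]; exact hd
  have hqS : q ≫ S'.hom = 𝟙 _ := by rw [← Over.w ι, ← Category.assoc, hq]; exact hp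
  have hy : IsClosed ({q.base (closedPoint ℂ)} : Set S'.left) :=
    Literature.AlgebraicGeometry.Dimension.isClosed_singleton_base_of_comp_eq_id S'.hom q hqS
  have hpt : pt 𝓜 p = ι.left.base (q.base (closedPoint ℂ)) := by
    rw [← hq]; rfl
  rw [hpt]
  exact Literature.AlgebraicGeometry.Dimension.finrank_cotangentSpace_stalk_eq_of_isOpenImmersion_of_isClosed'
    (MC 𝓜).hom ι.left d hy

/-- **Every `ℂ`-section of `𝓜_ℂ` (smooth) factors through an open piece smooth of SOME pure relative dimension** — the
open subscheme `V ⊆ 𝓜_ℂ` of ★ `Motives.exists_opens_smoothOfRelativeDimension_of_smooth` around `pt p`, as an object of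
`SchemeOver ℂ`, with the lift of `p`. [cite: GortzWedhorn2020, Prop. 6.15 (1)] -/
theorem exists_openPiece_of_section (𝓜 : SiegelFineModuliScheme g N δ) (hS : Smooth (MC 𝓜).hom)
    (p : Spec (CommRingCat.of ℂ) ⟶ (MC 𝓜).left) (_hp : IsSection 𝓜 p) :
    ∃ (S' : SchemeOver ℂ) (ι : S' ⟶ MC 𝓜) (_ : IsOpenImmersion ι.left) (d : ℕ) (_ : SmoothOfRelativeDimension d S'.hom)
      (q : Spec (CommRingCat.of ℂ) ⟶ S'.left), q ≫ ι.left = p := by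
  haveI : Smooth (MC 𝓜).hom := hS
  obtain ⟨V, d, hxV, hV⟩ :=
    Literature.AlgebraicGeometry.Dimension.exists_opens_smoothOfRelativeDimension (MC 𝓜).hom (pt 𝓜 p)
  -- the open piece as a `ℂ`-scheme
  let S' : SchemeOver ℂ := Over.mk (V.ι ≫ (MC 𝓜).hom)
  let ι : S' ⟶ MC 𝓜 := Over.homMk V.ι rfl
  haveI hι : IsOpenImmersion ι.left := by
    change AlgebraicGeometry.IsOpenImmersion V.ι
    infer_instance
  have hd : SmoothOfRelativeDimension d S'.hom := hV
  -- the lift of `p` (its image lies in `V`: `Spec ℂ` has one point)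
  have hrange : Set.range p.base ⊆ Set.range V.ι.base := by
    rw [Scheme.Opens.range_ι]
    haveI : Unique ↥(Spec (CommRingCat.of ℂ)) := inferInstanceAs (Unique (PrimeSpectrum ℂ))
    rintro _ ⟨z, rfl⟩
    rw [Subsingleton.elim z (closedPoint ℂ)]
    exact hxV
  let q : Spec (CommRingCat.of ℂ) ⟶ (V : Scheme) := IsOpenImmersion.lift V.ι p hrange
  have hq : q ≫ V.ι = p := IsOpenImmersion.lift_fac V.ι p hrange
  exact ⟨S', ι, hι, d, hd, q, hq⟩

/-- **`stub_le` REDUCED TO PIECES**: if every open piece `S' ↪ 𝓜_ℂ` smooth of pure relative dimension `d` that carries a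
`ℂ`-point has `d ≤ g(g+1)/2`, then `tdim 𝓜 (pt 𝓜 p) ≤ g(g+1)/2` at every section `p`. [cite: GortzWedhorn2020, Thm. 6.28 (vi)] -/
theorem tdim_le_of_openPieces (𝓜 : SiegelFineModuliScheme g N δ) (hS : Smooth (MC 𝓜).hom) {n : ℕ}
    (h : ∀ (S' : SchemeOver ℂ) (ι : S' ⟶ MC 𝓜) [IsOpenImmersion ι.left] (d : ℕ) [SmoothOfRelativeDimension d S'.hom]
      (q : Spec (CommRingCat.of ℂ) ⟶ S'.left), q ≫ S'.hom = 𝟙 _ → d ≤ n)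
    (p : Spec (CommRingCat.of ℂ) ⟶ (MC 𝓜).left) (hp : IsSection 𝓜 p) :
    tdim 𝓜 (pt 𝓜 p) ≤ n := by
  obtain ⟨S', ι, hι, d, hd, q, hq⟩ := exists_openPiece_of_section 𝓜 hS p hp
  haveI := hι
  haveI := hd
  have hqS : q ≫ S'.hom = 𝟙 _ := by rw [← Over.w ι, ← Category.assoc, hq]; exact hp
  rw [tdim_eq_of_openPiece 𝓜 hS ι d p hp q hq]
  exact h S' ι d q hqS

/-- **`stub_ge` REDUCED TO PIECES**: if every open piece `S' ↪ 𝓜_ℂ` smooth of pure relative dimension `d` that carries a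
`ℂ`-point has `n ≤ d`, then `n ≤ tdim 𝓜 (pt 𝓜 p)` at every section `p`. [cite: GortzWedhorn2020, Thm. 6.28 (vi)] -/
theorem le_tdim_of_openPieces (𝓜 : SiegelFineModuliScheme g N δ) (hS : Smooth (MC 𝓜).hom) {n : ℕ}
    (h : ∀ (S' : SchemeOver ℂ) (ι : S' ⟶ MC 𝓜) [IsOpenImmersion ι.left] (d : ℕ) [SmoothOfRelativeDimension d S'.hom]
      (q : Spec (CommRingCat.of ℂ) ⟶ S'.left), q ≫ S'.hom = 𝟙 _ → n ≤ d)
    (p : Spec (CommRingCat.of ℂ) ⟶ (MC 𝓜).left) (hp : IsSection 𝓜 p) :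
    n ≤ tdim 𝓜 (pt 𝓜 p) := by
  obtain ⟨S', ι, hι, d, hd, q, hq⟩ := exists_openPiece_of_section 𝓜 hS p hp
  haveI := hι
  haveI := hd
  have hqS : q ≫ S'.hom = 𝟙 _ := by rw [← Over.w ι, ← Category.assoc, hq]; exact hp
  rw [tdim_eq_of_openPiece 𝓜 hS ι d p hp q hq]
  exact h S' ι d q hqS

/-- **`stub_le` from (F) and the piece bound** (the form the skeleton consumes: binders of `stub_le` verbatim, plus the
piece hypothesis). -/
theorem stub_le_of_openPieces (hF : lan2013_siegelFineModuliScheme) (hg : 0 < g) (hδ : IsPolarizationType δ)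
    (hN : 3 ≤ N) (𝓜 : SiegelFineModuliScheme g N δ)
    (h : ∀ (S' : SchemeOver ℂ) (ι : S' ⟶ MC 𝓜) [IsOpenImmersion ι.left] (d : ℕ) [SmoothOfRelativeDimension d S'.hom]
      (q : Spec (CommRingCat.of ℂ) ⟶ S'.left), q ≫ S'.hom = 𝟙 _ → d ≤ g * (g + 1) / 2)
    (p : Spec (CommRingCat.of ℂ) ⟶ (MC 𝓜).left) (hp : IsSection 𝓜 p) :
    tdim 𝓜 (pt 𝓜 p) ≤ g * (g + 1) / 2 :=
  tdim_le_of_openPieces 𝓜 (smooth_MC_of_F hF hg hδ hN 𝓜) h p hp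

/-- **`stub_ge` from (F) and the piece bound.** -/
theorem stub_ge_of_openPieces (hF : lan2013_siegelFineModuliScheme) (hg : 0 < g) (hδ : IsPolarizationType δ)
    (hN : 3 ≤ N) (𝓜 : SiegelFineModuliScheme g N δ)
    (h : ∀ (S' : SchemeOver ℂ) (ι : S' ⟶ MC 𝓜) [IsOpenImmersion ι.left] (d : ℕ) [SmoothOfRelativeDimension d S'.hom]
      (q : Spec (CommRingCat.of ℂ) ⟶ S'.left), q ≫ S'.hom = 𝟙 _ → g * (g + 1) / 2 ≤ d)
    (p : Spec (CommRingCat.of ℂ) ⟶ (MC 𝓜).left) (hp : IsSection 𝓜 p) :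
    g * (g + 1) / 2 ≤ tdim 𝓜 (pt 𝓜 p) :=
  le_tdim_of_openPieces 𝓜 (smooth_MC_of_F hF hg hδ hN 𝓜) h p hp

end EquidimOfF

end Literature.AlgebraicGeometry.ModuliOfAbelianVarieties


end

/-!
# E-road `stub_le′` — «every smooth open piece of `𝓜_ℂ` with a `ℂ`-point has relative dimension ≤ g(g+1)/2»,
# REAL over the P4-piece socket (G-AN1) + ★ Brouwer invariance of dimension + ★ P6 (B-p01 (g13); road (AN) of record,
# B-plan1 (g13) 18:23:42Z)

HOME probe, no `sorry`.  The ONE hypothesis is B-p03 (g14)'s P4-piece TEXT `UHead.Ue_P4_piece` (PASTED token-identically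
from `B-provers/B-p03/piece/P4piece-text.v1.lean` 0225915a :43–:75; G-AN1, being built HOME tonight).  Proof: the fibre triple
`P₀` at the point `ι t₀` (★ `SiegelFineModuliScheme.exists_triple_isBaseChangeVia_classifyingPoint_eq`) is admissible at some
`(Z₀, r)` with `r` a principal representative (★ `UHead.exists_residue_isAdmissibleAt`); the P4-piece map `π : W → 𝔥_g`
(`W ∋ t₀` open in `S′(ℂ)`, continuous, reading admissibility at `r`) is INJECTIVE on `W` by ★ P6
`UHead.classifyingMap_eq_of_isAdmissibleAt` and the monomorphism `ι`; in the algebraic chart ★ `ComplexPoints.algebraicChart S′ d t₀`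
and the upper-triangular coordinates of symmetric matrices, `π` becomes a continuous injection from a non-empty open of `ℂ^d`
into `ℂ^{Sym2 (Fin g)}`, so ★ Brouwer `Literature.Topology.Euclidean.Brouwer.finrank_le_of_injOn_of_isOpen` gives
`2d ≤ 2·#Sym2(Fin g) = 2·g(g+1)/2`.  HC_CM is proved only modulo the 7 printed citations until rung 0 closes.
-/

noncomputable section

open CategoryTheory CategoryTheory.Limits AlgebraicGeometry Matrix Topology
open Literature.AlgebraicGeometry.Motives (SchemeOver ComplexPoints AlgPoints specOver AbelianVariety CartierDivisor fiberOver)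
open Literature.AlgebraicGeometry.AbelianSchemes (PolarizedAbelianSchemeWithLevel AbelianSchemeOver)
open Literature.NumberTheory.Automorphic (siegelUpperHalfSpace)
open Literature.NumberTheory.Adeles

namespace Literature.AlgebraicGeometry.ModuliOfAbelianVarieties

open SiegelModuli

namespace UHead

/-- **SOCKET P4-piece** — PASTED token-identically from B-p03 (g14) `B-provers/B-p03/piece/P4piece-text.v1.lean` 0225915a (HOME;
G-AN1 of the E-road): the local holomorphic period map of the universal family ON A SMOOTH PIECE `ι : S′ ⟶ 𝓜_ℂ` of the base,
reading admissibility at `r` at triples classified by `ι x`.  Statement only. [cite: LangeBirkenhake1992, Ch. 8 §8.1–8.2]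
[cite: VoisinHodgeI2002, §10.2.1 Thm. 10.3] [cite: MumfordFogartyKirwan1994, Appendix to Ch. 7 §A (p. 235)] -/
def Ue_P4_piece : Prop :=
  ∀ (g N : ℕ) (δ : Fin g → ℕ) (_hg : 0 < g) (hδ : IsPolarizationType δ) (_hN : 3 ≤ N)
    (𝓜 : SiegelFineModuliScheme g N δ) (r : gspFinAdelic δ)
    {S' : SchemeOver ℂ} (ι : S' ⟶ (Motives.baseChange ℚ ℂ).obj 𝓜.M) [IsOpenImmersion ι.left]
    (_hSq : HodgeTheory.IsQuasiProjectiveOver S')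
    (d : ℕ) [SmoothOfRelativeDimension d S'.hom],
    haveI : IsLocallyNoetherian (specOver ℚ ℂ).left :=
      inferInstanceAs (IsLocallyNoetherian (Spec (CommRingCat.of ℂ)))
    haveI : Smooth S'.hom := SmoothOfRelativeDimension.smooth d _
    haveI : LocallyOfFiniteType S'.hom := inferInstance
    r ∈ principalLevelSubgroup δ 1 →
    ∀ (Z₀ : Matrix (Fin g) (Fin g) ℂ) (hZ₀ : Z₀ ∈ siegelUpperHalfSpace g)
      (P₀ : PolarizedAbelianSchemeWithLevel g N δ (specOver ℚ ℂ).left), IsAdmissibleAt hδ r Z₀ hZ₀ P₀ →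
    ∀ (t₀ : ComplexPoints S'),
      AlgPoints.map (L := ℂ) ι t₀ =
        AlgPoints.baseChangeEquiv (algebraMap ℚ ℂ) 𝓜.M (𝓜.classifyingMap (specOver ℚ ℂ) P₀) →
    ∃ (W : Set (ComplexPoints S')) (π : ComplexPoints S' → Matrix (Fin g) (Fin g) ℂ),
      IsOpen W ∧ t₀ ∈ W ∧ π t₀ = Z₀ ∧ ContinuousOn π W ∧
      -- `π` is holomorphic on `W`, entrywise, read in every holomorphic algebraic chart of `S′(ℂ)`
      (∀ x ∈ W, ∀ (i j : Fin g),
        DifferentiableOn ℂ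
          ((fun y ↦ π y i j) ∘ (ComplexPoints.algebraicChart S' d x).symm)
          ((ComplexPoints.algebraicChart S' d x).target ∩ (ComplexPoints.algebraicChart S' d x).symm ⁻¹' W)) ∧
      -- `π` READS ADMISSIBILITY at `r` on `W`, at triples classified by `ι x`
      (∀ x ∈ W, ∃ hx : π x ∈ siegelUpperHalfSpace g,
        ∃ P' : PolarizedAbelianSchemeWithLevel g N δ (specOver ℚ ℂ).left,
          IsAdmissibleAt hδ r (π x) hx P' ∧
          AlgPoints.baseChangeEquiv (algebraMap ℚ ℂ) 𝓜.M (𝓜.classifyingMap (specOver ℚ ℂ) P') = AlgPoints.map (L := ℂ) ι x)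

end UHead

namespace EquidimOfF

/-! ## §1 The upper-triangular coordinates of symmetric matrices (linear algebra) -/

/-- Symmetrised coordinates `Z ↦ (s ↦ Z i j + Z j i)` on `Sym2 (Fin g)`. [folklore] -/
def symCoord (g : ℕ) (Z : Matrix (Fin g) (Fin g) ℂ) : Sym2 (Fin g) → ℂ :=
  fun s ↦ Sym2.lift ⟨fun i j ↦ Z i j + Z j i, fun _ _ ↦ add_comm _ _⟩ s

/-- `symCoord` is continuous. [folklore] -/
theorem continuous_symCoord (g : ℕ) : Continuous (symCoord g) := by
  refine continuous_pi fun s ↦ ?_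
  induction s using Sym2.ind with
  | _ i j =>
    simp only [symCoord, Sym2.lift_mk]
    fun_prop

/-- `symCoord` is injective on SYMMETRIC matrices. [folklore] -/
theorem symCoord_injOn (g : ℕ) : Set.InjOn (symCoord g) {Z : Matrix (Fin g) (Fin g) ℂ | Z.IsSymm} := by
  intro Z hZ Z' hZ' h
  ext i j
  have hij := congrFun h s(i, j)
  simp only [symCoord, Sym2.lift_mk] at hij
  have h1 : Z j i = Z i j := by simpa using congrFun (congrFun hZ i) j
  have h2 : Z' j i = Z' i j := by simpa using congrFun (congrFun hZ' i) j
  rw [h1, h2, ← two_mul, ← two_mul] at hij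
  exact mul_left_cancel₀ two_ne_zero hij

/-- `dim_ℝ (Sym2 (Fin g) → ℂ) = 2 · (g(g+1)/2)`. [folklore] -/
theorem finrank_real_sym2_fun (g : ℕ) : Module.finrank ℝ (Sym2 (Fin g) → ℂ) = 2 * (g * (g + 1) / 2) := by
  rw [Module.finrank_pi_fintype]
  simp only [Complex.finrank_real_complex, Finset.sum_const, Finset.card_univ, smul_eq_mul, Sym2.card,
    Fintype.card_fin, Nat.choose_two_right, Nat.add_sub_cancel]
  rw [Nat.mul_comm (g + 1) g, Nat.mul_comm _ 2]

/-- `dim_ℝ (Fin d → ℂ) = 2d`. [folklore] -/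
theorem finrank_real_fin_fun (d : ℕ) : Module.finrank ℝ (Fin d → ℂ) = 2 * d := by
  rw [Module.finrank_pi_fintype]
  simp only [Complex.finrank_real_complex, Finset.sum_const, Finset.card_univ, smul_eq_mul, Fintype.card_fin]
  rw [Nat.mul_comm]

/-! ## §2 `stub_le′` — REAL over the P4-piece socket -/

variable {g N : ℕ} {δ : Fin g → ℕ}

/-- **`stub_le′` (road (AN) of record): under the P4-piece socket, every open piece `ι : S′ ⟶ 𝓜_ℂ` smooth of pure relative
dimension `d` that carries a `ℂ`-point has `d ≤ g(g+1)/2`** — the local period map on `S′` is a continuous injection (P6) from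
a `d`-dimensional complex chart into the `g(g+1)/2`-dimensional space of symmetric matrices, so Brouwer's invariance of
dimension bounds `d`. [cite: Brouwer1911Dimension, Satz 1 (p. 161)] [cite: LangeBirkenhake1992, Ch. 8 §8.1]
[cite: MumfordFogartyKirwan1994, Appendix to Ch. 7 §A (p. 235)] -/
theorem stub_le' (hP4 : UHead.Ue_P4_piece) (hF : lan2013_siegelFineModuliScheme) (hg : 0 < g)
    (hδ : IsPolarizationType δ) (hN : 3 ≤ N) (𝓜 : SiegelFineModuliScheme g N δ)
    (S' : SchemeOver ℂ) (ι : S' ⟶ (Motives.baseChange ℚ ℂ).obj 𝓜.M) [IsOpenImmersion ι.left]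
    (d : ℕ) [hd : SmoothOfRelativeDimension d S'.hom]
    (q : Spec (CommRingCat.of ℂ) ⟶ S'.left) (hq : q ≫ S'.hom = 𝟙 _) :
    d ≤ g * (g + 1) / 2 := by
  classical
  haveI hLN : IsLocallyNoetherian (specOver ℚ ℂ).left :=
    inferInstanceAs (IsLocallyNoetherian (Spec (CommRingCat.of ℂ)))
  haveI : Smooth S'.hom := SmoothOfRelativeDimension.smooth d _
  haveI : LocallyOfFiniteType S'.hom := inferInstance
  -- quasi-projectivity of the piece, from (F)
  obtain ⟨-, hMq, -⟩ := W1.smooth_qproj_of_F hF hg hδ hN 𝓜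
  have hSq : HodgeTheory.IsQuasiProjectiveOver S' :=
    HodgeTheory.IsQuasiProjectiveOver.of_isOpenImmersion ι
      (Summit.HodgeConjecture.HodgeConjecture.Theorems.UnivFamilyHodgeFrames.isQuasiProjectiveOver_baseChange_M 𝓜 hMq)
  -- the `ℂ`-point `t₀` of `S′`
  have hq' : q ≫ S'.hom = (specOver ℂ ℂ).hom := by
    rw [hq]
    change 𝟙 _ = Spec.map (CommRingCat.ofHom (algebraMap ℂ ℂ))
    rw [Algebra.algebraMap_self, CommRingCat.ofHom_id, Spec.map_id]
  let t₀ : ComplexPoints S' := Over.homMk q hq'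
  -- the fibre triple at `ι t₀` and a principal residue representative at which it is admissible
  obtain ⟨P₀, -, -, -, hx₀⟩ := 𝓜.exists_triple_isBaseChangeVia_classifyingPoint_eq (AlgPoints.map (L := ℂ) ι t₀)
  obtain ⟨-, -, r, -, -, hr1, -, -, Z₀, hZ₀, hadm⟩ :=
    Summit.HodgeConjecture.CorCM.HypDel.UHead.exists_residue_isAdmissibleAt hg hδ hN P₀
  -- the P4-piece period map on an open `W ∋ t₀`
  obtain ⟨W, π, hWo, ht₀W, -, hπc, -, hread⟩ :=
    hP4 g N δ hg hδ hN 𝓜 r ι hSq d hr1 Z₀ hZ₀ P₀ hadm t₀ hx₀.symm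
  -- `π` is injective on `W` (P6 + `ι` mono) and symmetric-valued
  have hsymm : ∀ x ∈ W, (π x).IsSymm := fun x hx ↦
    ((Literature.NumberTheory.Automorphic.mem_siegelUpperHalfSpace_iff).1 (hread x hx).1).1
  have key : ∀ {Z Z' : Matrix (Fin g) (Fin g) ℂ} (_ : Z = Z') (hZ : Z ∈ siegelUpperHalfSpace g)
      (hZ' : Z' ∈ siegelUpperHalfSpace g) (P : PolarizedAbelianSchemeWithLevel g N δ (specOver ℚ ℂ).left),
      IsAdmissibleAt hδ r Z' hZ' P → IsAdmissibleAt hδ r Z hZ P := by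
    rintro Z Z' rfl hZ hZ' P h
    exact h
  have hinjW : Set.InjOn π W := by
    intro x hx y hy hxy
    obtain ⟨hxZ, Px, hPx, hclsx⟩ := hread x hx
    obtain ⟨hyZ, Py, hPy, hclsy⟩ := hread y hy
    have hcls : 𝓜.classifyingMap (specOver ℚ ℂ) Px = 𝓜.classifyingMap (specOver ℚ ℂ) Py :=
      Summit.HodgeConjecture.CorCM.HypDel.UHead.classifyingMap_eq_of_isAdmissibleAt g N δ hg hδ hN 𝓜 r hr1 (π x) hxZ
        Px Py hPx (key hxy hxZ hyZ Py hPy)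
    have hmap : AlgPoints.map (L := ℂ) ι x = AlgPoints.map (L := ℂ) ι y := by rw [← hclsx, ← hclsy, hcls]
    have hleft : x.left = y.left := by
      have h := congrArg CommaMorphism.left hmap
      simp only [AlgPoints.map_apply, Over.comp_left] at h
      exact (cancel_mono ι.left).1 h
    exact Over.OverMorphism.ext hleft
  -- the algebraic chart at `t₀` and the coordinate map
  let e := ComplexPoints.algebraicChart S' d t₀
  have ht₀e : t₀ ∈ e.source := ComplexPoints.mem_algebraicChart_source S' d t₀
  let U : Set (Fin d → ℂ) := e.target ∩ e.symm ⁻¹' W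
  have hUo : IsOpen U := e.isOpen_inter_preimage_symm hWo
  have hUne : U.Nonempty := ⟨e t₀, e.map_source ht₀e, by
    show e.symm (e t₀) ∈ W
    rw [e.left_inv ht₀e]; exact ht₀W⟩
  let f : (Fin d → ℂ) → (Sym2 (Fin g) → ℂ) := fun v ↦ symCoord g (π (e.symm v))
  have hπe : ContinuousOn (fun v ↦ π (e.symm v)) U :=
    hπc.comp (e.continuousOn_symm.mono Set.inter_subset_left) (fun v hv ↦ hv.2)
  have hfc : ContinuousOn f U := (continuous_symCoord g).comp_continuousOn hπe
  have hfinj : Set.InjOn f U := by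
    intro v hv v' hv' hvv'
    have h1 : π (e.symm v) = π (e.symm v') :=
      symCoord_injOn g (hsymm _ hv.2) (hsymm _ hv'.2) hvv'
    have h2 : e.symm v = e.symm v' := hinjW hv.2 hv'.2 h1
    exact e.symm.injOn hv.1 hv'.1 h2
  -- Brouwer
  have hB := Literature.Topology.Euclidean.Brouwer.finrank_le_of_injOn_of_isOpen hUo hUne hfc hfinj
  rw [finrank_real_fin_fun, finrank_real_sym2_fun] at hB
  omega

end EquidimOfF

end Literature.AlgebraicGeometry.ModuliOfAbelianVarieties


end

/-!
# E-road `stub_ge′` from THICKNESS — «a smooth open piece of `𝓜_ℂ` of relative dimension `d` that is THICK at a `ℂ`-point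
# has `g(g+1)/2 ≤ d`», REAL over ★ (O4) (B-p01 (g13); B-plan1 (g13) 18:25:29Z v1.1 plan «`stub_ge` = `stub_P4piece` +
# `stub_thick` + (O4)»)

HOME probe, no `sorry`.  `IsThickAt hδ 𝓜 ι d t` = THICK in tree words: at the complex point `t` of the piece `ι : S′ ⟶ 𝓜_ℂ`
there is a local period map as in the P4-piece socket (open `W ∋ t`, `π` continuous, chart-holomorphic, reading admissibility
at a principal `r` at triples classified by `ι x`) whose image of `W ∩ (the algebraic chart at t).source` contains a non-empty
OPEN subset of `𝔥_g`.  Then (O4) ★ `Literature.Topology.Euclidean.finrank_complex_le_of_differentiableOn_of_nonempty_interior`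
applied to `π` read in the chart at `t` and in Klingen's coordinates ★ `coordUHS` of `𝔥_g` gives `g(g+1)/2 ≤ d`.  The honest
residual of the E-road is therefore `stub_thick : every ℂ-point of every smooth open piece of 𝓜_ℂ is thick` (U-d / continuity
of the classifying map / Hecke-link; NOT ★).  HC_CM is proved only modulo the 7 printed citations until rung 0 closes.
-/

noncomputable section

open CategoryTheory CategoryTheory.Limits AlgebraicGeometry Matrix Topology
open Literature.AlgebraicGeometry.Motives (SchemeOver ComplexPoints AlgPoints specOver)
open Literature.AlgebraicGeometry.AbelianSchemes (PolarizedAbelianSchemeWithLevel)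
open Literature.NumberTheory.Automorphic (siegelUpperHalfSpace)
open Literature.NumberTheory.Adeles
open Literature.NumberTheory.ModularForms Literature.NumberTheory.ModularForms.SiegelUpperHalfSpace

namespace Literature.AlgebraicGeometry.ModuliOfAbelianVarieties

open SiegelModuli

namespace EquidimOfF

variable {g N : ℕ} {δ : Fin g → ℕ}

/-! ## §1 THICK points: ★ `EquidimOfF.IsThickAt` / `IsThickAtWith` BY IMPORT (★ p745366 `SiegelModuliThickPoints`, germ form; v1.3) -/

/-! ## §2 Symmetrised coordinates (as in `StubLePrime`) -/

/-- On `𝔥_g`, `symCoord` is twice Klingen's coordinate map `coordUHS`. [cite: Klingen1990, Ch. I §1 Def. 2 (p. 2)] -/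
theorem symCoord_coe (z : siegelUpperHalfSpace g) : symCoord g (z : Matrix (Fin g) (Fin g) ℂ) = (2 : ℂ) • coordUHS z := by
  ext s
  induction s using Sym2.ind with
  | _ i j =>
    simp only [symCoord, Sym2.lift_mk, Pi.smul_apply, coordUHS_apply_mk, smul_eq_mul]
    have h : (z : Matrix (Fin g) (Fin g) ℂ) j i = (z : Matrix (Fin g) (Fin g) ℂ) i j := z.2.1.apply i j
    rw [h, two_mul]

/-- `dim_ℂ (Sym2 (Fin g) → ℂ) = g(g+1)/2`. [folklore] -/
theorem finrank_complex_sym2_fun (g : ℕ) : Module.finrank ℂ (Sym2 (Fin g) → ℂ) = g * (g + 1) / 2 := by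
  rw [Module.finrank_pi ℂ, Sym2.card, Fintype.card_fin, Nat.choose_two_right, Nat.add_sub_cancel, Nat.mul_comm]

/-! ## §3 THICK ⇒ `g(g+1)/2 ≤ d` (REAL over ★ (O4)) -/

/-- **A smooth open piece of `𝓜_ℂ` that is THICK at a complex point has relative dimension `≥ g(g+1)/2`**: in the algebraic
chart at `t` and Klingen's coordinates, the period map is a holomorphic map from an open of `ℂ^d` whose image contains an
open of `ℂ^{g(g+1)/2}`, so (O4) bounds the dimensions. [cite: Mattila1995, Thm. 7.5] [cite: LangeBirkenhake1992, Ch. 8 §8.1] -/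
theorem le_of_isThickAt (hδ : IsPolarizationType δ) (𝓜 : SiegelFineModuliScheme g N δ) {S' : SchemeOver ℂ}
    (ι : S' ⟶ (Motives.baseChange ℚ ℂ).obj 𝓜.M) (d : ℕ) [SmoothOfRelativeDimension d S'.hom]
    (t : ComplexPoints S') (h : IsThickAt hδ 𝓜 ι d t) : g * (g + 1) / 2 ≤ d :=
  Summit.HodgeConjecture.HodgeConjecture.Theorems.EquidimThickIffLe.le_of_isThickAt hδ 𝓜 ι d t h

/-- **`stub_ge′` from `stub_thick`**: if every complex point of every smooth open piece is thick, every such piece with a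
`ℂ`-point has relative dimension `≥ g(g+1)/2` (the v1.1 shape: `stub_ge′ := stub_ge'_of_thick stub_thick`). -/
theorem stub_ge'_of_thick (hδ : IsPolarizationType δ) (𝓜 : SiegelFineModuliScheme g N δ)
    (hthick : ∀ (S' : SchemeOver ℂ) (ι : S' ⟶ (Motives.baseChange ℚ ℂ).obj 𝓜.M) [IsOpenImmersion ι.left]
      (d : ℕ) [SmoothOfRelativeDimension d S'.hom] (t : ComplexPoints S'), IsThickAt hδ 𝓜 ι d t)
    (S' : SchemeOver ℂ) (ι : S' ⟶ (Motives.baseChange ℚ ℂ).obj 𝓜.M) [IsOpenImmersion ι.left]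
    (d : ℕ) [SmoothOfRelativeDimension d S'.hom]
    (q : Spec (CommRingCat.of ℂ) ⟶ S'.left) (hq : q ≫ S'.hom = 𝟙 _) : g * (g + 1) / 2 ≤ d := by
  have hq' : q ≫ S'.hom = (specOver ℂ ℂ).hom := by
    rw [hq]
    change 𝟙 _ = Spec.map (CommRingCat.ofHom (algebraMap ℂ ℂ))
    rw [Algebra.algebraMap_self, CommRingCat.ofHom_id, Spec.map_id]
  exact le_of_isThickAt hδ 𝓜 ι d (Over.homMk q hq') (hthick S' ι d _)

end EquidimOfF

end Literature.AlgebraicGeometry.ModuliOfAbelianVarieties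


/-! # §HEAD — THE E-ROAD COMPOSED: `(F) ⇒ (F′)` REAL modulo EXACTLY {P4-piece socket (G-AN1), `StubThick`} (B-p01 (g13)) -/

namespace Literature.AlgebraicGeometry.ModuliOfAbelianVarieties.EquidimOfF

open CategoryTheory AlgebraicGeometry
open Literature.AlgebraicGeometry.Motives (SchemeOver ComplexPoints AlgPoints specOver)

/-- **`StubThick` — the honest residual of the E-road (proposed `stub_thick` TEXT, ∀-form)**: given (F), every complex point of
every smooth open piece of every `𝓜_ℂ` is THICK (`IsThickAt`).  Equivalent, given the P4-piece socket and ★ invariance of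
domain, to «no THIN clopen piece of `𝓜_ℂ`» = U-d connectedness = continuity of the classifying map; roads: Hecke-link (L–XL,
B-p14 (g14) census fa47bad8 §4), realisation (XL), properness (XL).  Statement only. [cite: MumfordFogartyKirwan1994, Appendix to Ch. 7 §A (p. 235, fn. 20)] -/
def StubThick : Prop :=
  ∀ (_hF : lan2013_siegelFineModuliScheme) (g N : ℕ) (δ : Fin g → ℕ) (_hg : 0 < g) (hδ : IsPolarizationType δ) (_hN : 3 ≤ N)
    (𝓜 : SiegelFineModuliScheme g N δ) (S' : SchemeOver ℂ) (ι : S' ⟶ (Motives.baseChange ℚ ℂ).obj 𝓜.M)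
    [IsOpenImmersion ι.left] (d : ℕ) [SmoothOfRelativeDimension d S'.hom] (t : ComplexPoints S'), IsThickAt hδ 𝓜 ι d t

variable {g N : ℕ} {δ : Fin g → ℕ}

/-- **`stub_le` OF THE E-ROAD, REAL MODULO THE P4-PIECE SOCKET (G-AN1)** (skeleton v1 `stub_le` text + the ONE hypothesis `hP4`).
[cite: Brouwer1911Dimension, Satz 1 (p. 161)] [cite: LangeBirkenhake1992, Ch. 8 §8.1] -/
theorem stub_le_of_P4piece (hP4 : UHead.Ue_P4_piece) (hF : lan2013_siegelFineModuliScheme)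
    (hg : 0 < g) (hδ : IsPolarizationType δ) (hN : 3 ≤ N) (𝓜 : SiegelFineModuliScheme g N δ)
    (p : Spec (CommRingCat.of ℂ) ⟶ (MC 𝓜).left) (hp : IsSection 𝓜 p) :
    tdim 𝓜 (pt 𝓜 p) ≤ g * (g + 1) / 2 :=
  stub_le_of_openPieces hF hg hδ hN 𝓜 (fun S' ι hι d hd q hq ↦ @stub_le' g N δ hP4 hF hg hδ hN 𝓜 S' ι hι d hd q hq) p hp

/-- **`stub_ge` OF THE E-ROAD, REAL MODULO `StubThick`** (skeleton v1 `stub_ge` text + the ONE hypothesis `hthick`).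
[cite: Mattila1995, Thm. 7.5] [cite: LangeBirkenhake1992, Ch. 8 §8.1] -/
theorem stub_ge_of_thick (hthick : StubThick) (hF : lan2013_siegelFineModuliScheme)
    (hg : 0 < g) (hδ : IsPolarizationType δ) (hN : 3 ≤ N) (𝓜 : SiegelFineModuliScheme g N δ)
    (p : Spec (CommRingCat.of ℂ) ⟶ (MC 𝓜).left) (hp : IsSection 𝓜 p) :
    g * (g + 1) / 2 ≤ tdim 𝓜 (pt 𝓜 p) :=
  stub_ge_of_openPieces hF hg hδ hN 𝓜
    (fun S' ι hι d hd q hq ↦ @stub_ge'_of_thick g N δ hδ 𝓜 (fun S'' ι' hι' d' hd' t ↦ @hthick hF g N δ hg hδ hN 𝓜 S'' ι' hι' d' hd' t)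
      S' ι hι d hd q hq) p hp

/-- REAL (skeleton v1 §2, Mathlib `pointOfClosedPoint`): every closed point of `𝓜_ℂ` is the image of a `ℂ`-section. -/
theorem exists_section_of_isClosed (𝓜 : SiegelFineModuliScheme g N δ) [LocallyOfFiniteType (MC 𝓜).hom]
    (x : (MC 𝓜).left) (hx : IsClosed ({x} : Set (MC 𝓜).left)) :
    ∃ p : Spec (CommRingCat.of ℂ) ⟶ (MC 𝓜).left, IsSection 𝓜 p ∧ pt 𝓜 p = x :=
  ⟨pointOfClosedPoint (MC 𝓜).hom x hx, pointOfClosedPoint_comp _ _ _, pointOfClosedPoint_apply _ _ _ _⟩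

/-- The closed-point tangent count of `𝓜_ℂ` from the two residual sockets (skeleton v1 §3 shape). -/
theorem tdim_eq_of_P4piece_of_thick (hP4 : UHead.Ue_P4_piece) (hthick : StubThick) (hF : lan2013_siegelFineModuliScheme)
    (hg : 0 < g) (hδ : IsPolarizationType δ) (hN : 3 ≤ N) (𝓜 : SiegelFineModuliScheme g N δ) :
    ∀ x : (MC 𝓜).left, IsClosed ({x} : Set (MC 𝓜).left) → tdim 𝓜 x = g * (g + 1) / 2 := by
  intro x hx
  haveI : Smooth (MC 𝓜).hom := smooth_MC_of_F hF hg hδ hN 𝓜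
  haveI : LocallyOfFiniteType (MC 𝓜).hom := inferInstance
  obtain ⟨p, hp, rfl⟩ := exists_section_of_isClosed 𝓜 x hx
  exact le_antisymm (stub_le_of_P4piece hP4 hF hg hδ hN 𝓜 p hp) (stub_ge_of_thick hthick hF hg hδ hN 𝓜 p hp)

/-- **EQUIDIM for every carrier, from (F) and the two residual sockets** (skeleton v1 §3 glue: ★ E6 over `ℂ` ∘ ★ field descent).
[cite: GortzWedhorn2020, Prop. 6.15 (1), Lemma 6.26] [cite: GortzWedhorn2023, Thm. 27.301 p. 733] -/
theorem smoothOfRelativeDimension_of_F_of_P4piece_of_thick (hP4 : UHead.Ue_P4_piece) (hthick : StubThick)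
    (hF : lan2013_siegelFineModuliScheme) (hg : 0 < g) (hδ : IsPolarizationType δ) (hN : 3 ≤ N)
    (𝓜 : SiegelFineModuliScheme g N δ) : SmoothOfRelativeDimension (g * (g + 1) / 2) 𝓜.M.hom := by
  haveI := smooth_MC_of_F hF hg hδ hN 𝓜
  haveI : SmoothOfRelativeDimension (g * (g + 1) / 2) (MC 𝓜).hom :=
    Literature.AlgebraicGeometry.Dimension.smoothOfRelativeDimension_of_forall_isClosed_finrank_cotangentSpace_eq
      (MC 𝓜).hom _ (tdim_eq_of_P4piece_of_thick hP4 hthick hF hg hδ hN 𝓜)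
  exact Literature.AlgebraicGeometry.Limits.smoothOfRelativeDimension_hom_of_baseChangeHom_obj (algebraMap ℚ ℂ) _ 𝓜.M

/-- **THE E-ROAD HEAD, COMPOSED: (F) ⇒ (F′) (★ p737414 `lan2013_siegelFineModuliScheme_relDim`, BY IMPORT) REAL modulo
EXACTLY the P4-piece socket (G-AN1) and `StubThick`.** [cite: GortzWedhorn2023, Thm. 27.301 p. 733]
[cite: Lan2013PELCompactifications, Thm. 1.4.1.11 p. 91] -/
theorem relDim_of_F_of_P4piece_of_thick (hP4 : UHead.Ue_P4_piece) (hthick : StubThick)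
    (hF : lan2013_siegelFineModuliScheme) : lan2013_siegelFineModuliScheme_relDim := by
  intro g N δ hg hδ hN
  obtain ⟨𝓜, hs, hq, hX⟩ := hF g N δ hg hδ hN
  exact ⟨𝓜, hs, hq, hX, smoothOfRelativeDimension_of_F_of_P4piece_of_thick hP4 hthick hF hg hδ hN 𝓜⟩

end Literature.AlgebraicGeometry.ModuliOfAbelianVarieties.EquidimOfF

end


/-! # §REG — THE REGISTERED SHAPE (v1.1 cut; v1.4a texts) (B-plan1 (g15)): residual `NoThinPiece`, socket (B) `SocketQuotientMaps₈` (v8, REAL), quotient triples `SocketQuotientTriples₈` + the ONE stub, REAL glue, heads -/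

noncomputable section

open CategoryTheory CategoryTheory.Limits AlgebraicGeometry
open Literature.AlgebraicGeometry.Motives (SchemeOver ComplexPoints AlgPoints specOver)
open Literature.AlgebraicGeometry.AbelianSchemes (PolarizedAbelianSchemeWithLevel)
open Literature.NumberTheory.Automorphic (siegelUpperHalfSpace)
open Literature.NumberTheory.Adeles

namespace Literature.AlgebraicGeometry.ModuliOfAbelianVarieties.EquidimOfF

open SiegelModuli

/-- **`NoThinPiece` — THE residual of the E-road (registered `stub_noThinPiece` TEXT; weakest form, road-neutral)**: given (F)
and the P4-piece socket, every smooth open piece `ι : S′ ⟶ 𝓜_ℂ` of pure relative dimension `d` over `ℂ` carrying a `ℂ`-point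
has `g(g+1)/2 ≤ d` — «`𝓜_ℂ` has no THIN piece».  Implied by `StubThick` (`noThinPiece_of_thick`); equivalent to EQUIDIM of
`𝓜_g,δ,N` given G-AN1.  Roads: Hecke-link (L–XL), realisation = Kodaira–Spencer surjectivity (XL), properness of the period
map (XL).  Statement only. [cite: MumfordFogartyKirwan1994, Appendix to Ch. 7 §A (p. 235, fn. 20)]
[cite: Oort1971, Thm. 2.3.3 / Cor. 2.4.2] [cite: FaltingsChai1990, Ch. I §4 (Thm. 4.11, p. 24)] -/
def NoThinPiece : Prop :=
  ∀ (_hF : lan2013_siegelFineModuliScheme) (_hP4 : UHead.Ue_P4_piece) (g N : ℕ) (δ : Fin g → ℕ) (_hg : 0 < g)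
    (_hδ : IsPolarizationType δ) (_hN : 3 ≤ N) (𝓜 : SiegelFineModuliScheme g N δ)
    (S' : SchemeOver ℂ) (ι : S' ⟶ (Motives.baseChange ℚ ℂ).obj 𝓜.M) [IsOpenImmersion ι.left]
    (d : ℕ) [SmoothOfRelativeDimension d S'.hom]
    (q : Spec (CommRingCat.of ℂ) ⟶ S'.left), q ≫ S'.hom = 𝟙 _ → g * (g + 1) / 2 ≤ d

variable {g N : ℕ} {δ : Fin g → ℕ}

/-- **THICK ⇒ NO THIN PIECE (REAL)**: the realisation / properness roads close `stub_noThinPiece` through `StubThick`.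
[cite: Mattila1995, Thm. 7.5] [cite: LangeBirkenhake1992, Ch. 8 §8.1] -/
theorem noThinPiece_of_thick (hthick : StubThick) : NoThinPiece :=
  fun hF _ g N δ hg hδ hN 𝓜 S' ι hι d hd q hq ↦
    @stub_ge'_of_thick g N δ hδ 𝓜 (fun S'' ι' hι' d' hd' t ↦ @hthick hF g N δ hg hδ hN 𝓜 S'' ι' hι' d' hd' t)
      S' ι hι d hd q hq

/-! ## The former sorries of the E-road — ALL REAL since v1.5 (`stub_quotientTriples₈` = quotient triples over the piece, REAL over the COMPOSER; socket (B) `stub_quotientMaps₈` REAL over the (O-y) theorem since v1.4a; `stub_noThinPiece` REAL over (E-e); `stub_P4piece` REAL by import since v1.2) -/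

/-- **FORMER STUB 1 — `stub_P4piece`, REAL since v1.2 (G-AN1 given (F), «the P4 chain re-threaded to an open piece»):**
the P4-piece socket `UHead.Ue_P4_piece` (text = B-p03 (g14) `P4piece-text.v1.lean` 0225915a, file-local `def` above) from (F),
BY IMPORT of the lane-T head ★ `Summit.HodgeConjecture.HodgeConjecture.Theorems.UeP4OfFPiece.ue_P4_piece_of_F (hF)` (B-p03 (g14)
author, B-p11 (g13) filer; eleven `Theorems/*Piece*.lean` files, all `--as helper`), whose conclusion is this socket's text verbatim.
[cite: LangeBirkenhake1992, Ch. 8 §8.1–8.2] [cite: MumfordFogartyKirwan1994, Appendix to Ch. 7 §A (p. 235)] -/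
theorem stub_P4piece (hF : lan2013_siegelFineModuliScheme) : UHead.Ue_P4_piece :=
  Summit.HodgeConjecture.HodgeConjecture.Theorems.UeP4OfFPiece.ue_P4_piece_of_F hF

/- (v1.1/v1.2 docstring, kept as a comment) **THE ONE REMAINING STUB — `stub_noThinPiece` (XL, HARDEST; the ONE honest residual of
«EQUIDIM by proof»; HECKE-LINK line card v1.1):** `NoThinPiece`. [MumfordFogartyKirwan1994, App. 7A (p. 235, fn. 20)] [Oort1971,
Thm. 2.3.3 / Cor. 2.4.2].  v1.3: `stub_noThinPiece` is REAL over (E3) `EquidimNoThinPiece.noThinPiece_of_quotientMaps₂`; the ONE sorry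
moves one level down to socket (B) of the Hecke link (sockets v6), whose text is the file-local `SocketQuotientMaps` below.
   v1.4a: the socket text is v8 (`SocketQuotientMaps₈` below) and is REAL over the (O-y) assembler's theorem; the residual moves one MORE
   level down to `SocketQuotientTriples₈` (quotient triples over the thick open piece — abelian-scheme geometry only). -/

/-- **SOCKET (B) OF THE HECKE LINK — «THE ISOGENY-QUOTIENT MAP», TEXT v8** (bytes of record `B-plan/F-census/SOCKET-B-v8.text.B-plan1g15.lean`
50c62588c6da0372 = v6 (B-p01 (g13) probe v6 :1107 + `Odd (N′ / N)`, B-plan1 (g14) 21:50:29Z) with `[IsOpenImmersion ι'.left]`,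
`HeckeLinkedDeg … (N' / N)` (v7, B-plan1 (g15) 23:17:31Z / 23:19:57Z) and `Nat.Coprime (N' / N) (∏ i, δ i)` (v8, 23:33:35Z)): whenever the OPEN
piece `ι′ : S″ ⟶ 𝓜′_ℂ` has `ι′ s′` Hecke-linked to `x` at `r′` WITH similitude degree `N′/N`, `N′/N` is ODD and COPRIME TO `∏ δ i`, and `S″` is
thick at `s′` w.r.t. `r′`, there is a CONTINUOUS `Φ : S″(ℂ) → 𝓜_ℂ(ℂ)` with `Φ s′ = x`, an open `θ` and a principal `r` carrying admissibility
from `(ι′ s, Z, r′)` to `(Φ s, θ Z, r)`.  Statement-valued file-local `def`; = the type of the (O-y) theorem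
`EquidimHeckeQuotientFamily.socketQuotientMaps_of_quotientTriples` minus its last hypothesis `hQ`.
[cite: Milne2005ShimuraVarieties, §6 Thm. 6.11 pp. 74–75] [cite: MumfordFogartyKirwan1994, Appendix to Ch. 7 §A (p. 235)] -/
def SocketQuotientMaps₈ : Prop :=
  ∀ (_hF : lan2013_siegelFineModuliScheme) (g N N' : ℕ) (δ δ' : Fin g → ℕ) (_hg : 0 < g) (hδ : IsPolarizationType δ)
    (_hN : 3 ≤ N) (hδ' : IsPolarizationType δ') (𝓜 : SiegelFineModuliScheme g N δ) (𝓜' : SiegelFineModuliScheme g N' δ')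
    (S'' : SchemeOver ℂ) (ι' : S'' ⟶ (Motives.baseChange ℚ ℂ).obj 𝓜'.M) [IsOpenImmersion ι'.left]
    (d'' : ℕ) [SmoothOfRelativeDimension d'' S''.hom] (r' : gspFinAdelic δ') (_ : r' ∈ principalLevelSubgroup δ' 1)
    (s' : ComplexPoints S'') (_ : IsThickAtWith hδ' 𝓜' ι' d'' s' r')
    (x : ComplexPoints ((Motives.baseChange ℚ ℂ).obj 𝓜.M)),
    HeckeLinkedDeg 𝓜 𝓜' r' (AlgPoints.map (L := ℂ) ι' s') x (N' / N) → Odd (N' / N) → Nat.Coprime (N' / N) (∏ i, δ i) →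
    haveI : IsLocallyNoetherian (specOver ℚ ℂ).left := inferInstanceAs (IsLocallyNoetherian (Spec (CommRingCat.of ℂ)))
    ∃ (Φ : ComplexPoints S'' → ComplexPoints ((Motives.baseChange ℚ ℂ).obj 𝓜.M)) (_ : Continuous Φ) (_ : Φ s' = x)
      (θ : siegelUpperHalfSpace g → siegelUpperHalfSpace g) (_ : IsOpenMap θ)
      (r : gspFinAdelic δ) (_ : r ∈ principalLevelSubgroup δ 1),
      ∀ (s : ComplexPoints S'') (Z : siegelUpperHalfSpace g)
        (P' : PolarizedAbelianSchemeWithLevel g N' δ' (specOver ℚ ℂ).left),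
        IsAdmissibleAt hδ' r' Z.1 Z.2 P' →
        AlgPoints.baseChangeEquiv (algebraMap ℚ ℂ) 𝓜'.M (𝓜'.classifyingMap (specOver ℚ ℂ) P') = AlgPoints.map (L := ℂ) ι' s →
        ∃ P : PolarizedAbelianSchemeWithLevel g N δ (specOver ℚ ℂ).left,
          IsAdmissibleAt hδ r (θ Z).1 (θ Z).2 P ∧
          AlgPoints.baseChangeEquiv (algebraMap ℚ ℂ) 𝓜.M (𝓜.classifyingMap (specOver ℚ ℂ) P) = Φ s

open Matrix in open scoped MonObj in
/-- **QUOTIENT TRIPLES OVER THE THICK OPEN PIECE — the text of THE ONE REMAINING SORRY (v1.4a)** = the socket binders of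
`SocketQuotientMaps₈` through `Nat.Coprime (N′/N) (∏ δᵢ)` followed by the `hQ` hypothesis of the (O-y) theorem
`EquidimHeckeQuotientFamily.socketQuotientMaps_of_quotientTriples` VERBATIM (B-p21 (g14) ed.3 d5db76471c645e8b :210–:238; names qualified):
for every `ℚ`-descent `ι′ℚ : S″ → 𝓜′` of the open piece (`ι′ = ι′ℚ ⊗ ℂ`), every rational `γ` adapted to the link `(r, r′)` with
`γᵀ J_δ γ = (N′/N) J_δ′` and every integral matrix `γm` under it, the universal family pulled back to the piece `A′ := ι′ℚ^* 𝓜′.univ` admits a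
QUOTIENT TRIPLE: a polarized abelian scheme with level `Q` of level `N`, type `δ` over `S″` and a surjective locally-finite-type homomorphism
`ψ : A′ → Q.A` with (i) `Q`'s level sections = `ψ ∘ (σ′ᵢ)^{N′/N}`, (ii) fibrewise kernel = the level sections `σ′_c` with
`(γm · r′ mod N′) c = 0`, (iii) `IsLambdaOfAt`-compatibility `ψ_t^* Θ₀ ↔ λ′^{N′/N}` on every fibre.  Pure algebraic geometry of abelian
schemes over a smooth quasi-projective base ((ii)-chain `Q := (A′/K, λ_B, σ_B)`: D6 universal property `h4`, stable affine covers (cov-3),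
`hasType` ★ p751190, relative dimension (Q-dim), level/symplectic marking) — NO period map, NO complex analysis, NO moduli interpretation.
[cite: MumfordAV1970, §7 Thm. 4 p. 66; §23 p. 231] [cite: MumfordFogartyKirwan1994, Ch. 7 §3 Theorem 7.9 (p. 139)] -/
def SocketQuotientTriples₈ : Prop :=
  ∀ (_hF : lan2013_siegelFineModuliScheme) (g N N' : ℕ) (δ δ' : Fin g → ℕ) (_hg : 0 < g) (_hδ : IsPolarizationType δ)
    (_hN : 3 ≤ N) (hδ' : IsPolarizationType δ') (𝓜 : SiegelFineModuliScheme g N δ) (𝓜' : SiegelFineModuliScheme g N' δ')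
    (S'' : SchemeOver ℂ) (ι' : S'' ⟶ (Motives.baseChange ℚ ℂ).obj 𝓜'.M) [IsOpenImmersion ι'.left]
    (d'' : ℕ) [SmoothOfRelativeDimension d'' S''.hom] (r' : gspFinAdelic δ') (hr' : r' ∈ principalLevelSubgroup δ' 1)
    (s' : ComplexPoints S'') (_ : IsThickAtWith hδ' 𝓜' ι' d'' s' r')
    (x : ComplexPoints ((Motives.baseChange ℚ ℂ).obj 𝓜.M)),
    HeckeLinkedDeg 𝓜 𝓜' r' (AlgPoints.map (L := ℂ) ι' s') x (N' / N) → Odd (N' / N) → Nat.Coprime (N' / N) (∏ i, δ i) →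
    ∀ [NeZero N'] (ι'ℚ : S''.restrictScalars ℚ ⟶ 𝓜'.M)
      (_ : ι'.left ≫ Motives.baseChangeHomFst (algebraMap ℚ ℂ) 𝓜'.M = ι'ℚ.left)
      (γq : GL (Fin g ⊕ Fin g) ℚ) (r : gspFinAdelic δ) (_ : r ∈ principalLevelSubgroup δ 1),
      QuotientAdapted δ δ' N N' r r' γq →
      (γq : Matrix (Fin g ⊕ Fin g) (Fin g ⊕ Fin g) ℚ)ᵀ * typeFormOver δ ℚ *
        (γq : Matrix (Fin g ⊕ Fin g) (Fin g ⊕ Fin g) ℚ) = (((N' / N : ℕ) : ℚ)) • typeFormOver δ' ℚ →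
      ∀ (γm : Matrix (Fin g ⊕ Fin g) (Fin g ⊕ Fin g) ℤ),
      ((γq : GL (Fin g ⊕ Fin g) ℚ) : Matrix (Fin g ⊕ Fin g) (Fin g ⊕ Fin g) ℚ) = γm.map (Int.cast : ℤ → ℚ) →
      ∃ (Q : PolarizedAbelianSchemeWithLevel g N δ S''.left)
        (ψ : (PolarizedAbelianSchemeWithLevel.baseChange (S' := S''.left) 𝓜'.univ ι'ℚ.left).A.X ⟶ Q.A.X) (_ : IsMonHom ψ)
        (_ : Surjective ψ.left) (_ : LocallyOfFiniteType ψ.left),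
        (∀ i, Q.level.σ i =
          ((PolarizedAbelianSchemeWithLevel.baseChange (S' := S''.left) 𝓜'.univ ι'ℚ.left).level.σ i ^ (N' / N)) ≫ ψ) ∧
        (∀ (s : ComplexPoints S'')
          (x : (PolarizedAbelianSchemeWithLevel.baseChange (S' := S''.left) 𝓜'.univ ι'ℚ.left).A.FibrePoints s.left),
          x ≫ ψ = 1 ↔ ∃ c ∈ {c : Fin g ⊕ Fin g → ZMod N' |
              (γm.map (Int.castRingHom (ZMod N')) *
                Matrix.of (fun i j => integralAdeleResidue N'
                  ⟨((r' : GL (Fin g ⊕ Fin g) finAdeleQ) : Matrix (Fin g ⊕ Fin g) (Fin g ⊕ Fin g) finAdeleQ) i j,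
                    entries_mem_integralAdeles_of_mem_principalLevelSubgroup_one hr' i j⟩)) *ᵥ c = 0},
            x = (PolarizedAbelianSchemeWithLevel.baseChange (S' := S''.left) 𝓜'.univ ι'ℚ.left).A.restrict s.left
              ((PolarizedAbelianSchemeWithLevel.baseChange (S' := S''.left) 𝓜'.univ ι'ℚ.left).level.section_ c)) ∧
        (∀ (t : Spec (.of ℂ) ⟶ S''.left) (Θ₀ : Motives.CartierDivisor (Q.A.fibre t).toAbelianVariety.X.left),
          haveI := AbelianSchemes.AbelianSchemeOver.isDominant_toSchemeHom_fibreHom ψ t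
          Q.A.IsLambdaOfAt t Q.D Q.pol.lam Θ₀ →
            (PolarizedAbelianSchemeWithLevel.baseChange (S' := S''.left) 𝓜'.univ ι'ℚ.left).A.IsLambdaOfAt t
              (PolarizedAbelianSchemeWithLevel.baseChange (S' := S''.left) 𝓜'.univ ι'ℚ.left).D
              ((PolarizedAbelianSchemeWithLevel.baseChange (S' := S''.left) 𝓜'.univ ι'ℚ.left).pol.lam ^ (N' / N))
              (Θ₀.pullback (Motives.AbelianVariety.Hom.toSchemeHom (AbelianSchemes.AbelianSchemeOver.fibreHom ψ t))))

/-- **`stub_quotientTriples₈` — quotient triples over the thick open piece, REAL since v1.5** (the (ii)-chain: was the ONE remaining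
`sorry` of v1.4a) := ★ p753187 `EquidimHeckeQuotientTriplesOfPiece.socketQuotientTriples_of_ext` (B-p21 (g14): the glue ★ p753076
`exists_heckeQuotientTriple_of_ext` over the generic `Q`-builder ★ p751582 `HeckeQuotientTriple.exists_quotientTriple_of_fields`, at the
piece) fed with the COMPOSER ★ `EquidimHExtOfPiece.hExt_of_piece` (B-p04 (g18): the `hExt` package — covers, quotient group laws, D6 `h4`,
isotropy ⇒ `Φ`, `hlam`, `polB`, `htype` — conjunct by conjunct over the B fan's ★ files; see the v1.5 DELTA above).
[cite: MumfordAV1970, §7 Thm. 4 p. 66; §23 Thm. 2 p. 231] [cite: MumfordFogartyKirwan1994, Ch. 7 §3 Theorem 7.9 (p. 139)] -/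
theorem stub_quotientTriples₈ : SocketQuotientTriples₈ := by
  intro hF g N N' δ δ' hg hδ hN hδ' 𝓜 𝓜' S'' ι' _ d'' _ r' hr' s' hth x hlink hodd hcop _ ι'ℚ hι γq r hr hQA hsim γm hγ
  exact Summit.HodgeConjecture.HodgeConjecture.Theorems.EquidimHeckeQuotientTriplesOfPiece.socketQuotientTriples_of_ext
    hF g N N' δ δ' hg hδ hN hδ' 𝓜 𝓜' S'' ι' d'' r' hr' s' hth x hlink hodd hcop ι'ℚ hι γq r hr hQA hsim γm hγ
    (Summit.HodgeConjecture.HodgeConjecture.Theorems.EquidimHExtOfPiece.hExt_of_piece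
      hF g N N' δ δ' hg hδ hN hδ' 𝓜 𝓜' S'' ι' d'' r' hr' s' hth x hlink hodd hcop ι'ℚ hι γq r hr hQA hsim γm hγ)

/-- **`stub_quotientMaps₈` — socket (B) v8, REAL since v1.4a** := the (O-y) assembler's theorem
`EquidimHeckeQuotientFamily.socketQuotientMaps_of_quotientTriples` BY NAME (B-p21 (g14) / B-p04 (g17): quotient triples ⇒ ★ p748400 `hfam`
⇒ ★ p745772 `∃ Φ` continuous + admissibility transport), fed with `stub_quotientTriples₈`.
[cite: Milne2005ShimuraVarieties, §6 Thm. 6.11 pp. 74–75] [cite: MumfordFogartyKirwan1994, Appendix to Ch. 7 §A (p. 235)] -/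
theorem stub_quotientMaps₈ : SocketQuotientMaps₈ := by
  intro hF g N N' δ δ' hg hδ hN hδ' 𝓜 𝓜' S'' ι' _ d'' _ r' hr' s' hth x hlink hodd hcop
  exact Summit.HodgeConjecture.HodgeConjecture.Theorems.EquidimHeckeQuotientFamily.socketQuotientMaps_of_quotientTriples hF g N N' δ δ'
    hg hδ hN hδ' 𝓜 𝓜' S'' ι' d'' r' hr' s' hth x hlink hodd hcop
    (stub_quotientTriples₈ hF g N N' δ δ' hg hδ hN hδ' 𝓜 𝓜' S'' ι' d'' r' hr' s' hth x hlink hodd hcop)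

/-- **`stub_noThinPiece` — REAL since v1.3; over (E-e) since v1.4a**: `EquidimNoThinPieceOpen.noThinPiece_of_quotientMaps₃` ((E-c) socket (A) re-export ★ `thickLinkedLift_heckeLinkedDeg_odd_open`,
(T2) ★ p746147, THICK ⇔ NOT THIN ★ p746146, (R4) ★ p744781) and `stub_quotientMaps₈` (REAL over the (O-y) theorem, modulo `stub_quotientTriples₈`).
[cite: MumfordFogartyKirwan1994, Appendix to Ch. 7 §A (p. 235, fn. 20)] [cite: Oort1971, Thm. 2.3.3 / Cor. 2.4.2] -/
theorem stub_noThinPiece : NoThinPiece :=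
  fun hF _ g N δ hg hδ hN 𝓜 S' ι hι d hd q hq ↦
    @Summit.HodgeConjecture.HodgeConjecture.Theorems.EquidimNoThinPieceOpen.noThinPiece_of_quotientMaps₃ g hF stub_quotientMaps₈
      N δ hg hδ hN 𝓜 S' ι hι d hd q hq

/-! ## REAL glue: the v1 stub texts as theorems, the v1 head, the hDel junction -/

/-- **`stub_ge` at sections from `NoThinPiece`** (piece reduction ★-shaped: `stub_ge_of_openPieces`). -/
theorem stub_ge_of_noThinPiece (hno : NoThinPiece) (hP4 : UHead.Ue_P4_piece) (hF : lan2013_siegelFineModuliScheme)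
    (hg : 0 < g) (hδ : IsPolarizationType δ) (hN : 3 ≤ N) (𝓜 : SiegelFineModuliScheme g N δ)
    (p : Spec (CommRingCat.of ℂ) ⟶ (MC 𝓜).left) (hp : IsSection 𝓜 p) :
    g * (g + 1) / 2 ≤ tdim 𝓜 (pt 𝓜 p) :=
  stub_ge_of_openPieces hF hg hδ hN 𝓜 (fun S' ι hι d hd q hq ↦ @hno hF hP4 g N δ hg hδ hN 𝓜 S' ι hι d hd q hq) p hp

/-- **`stub_le` — v1 :111 TEXT VERBATIM, now a THEOREM** over `stub_P4piece` (★ Brouwer + ★ P6, B-p01 (g13) `stub_le'`).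
[cite: Brouwer1911Dimension, Satz 1 (p. 161)] [cite: LangeBirkenhake1992, Ch. 8 §8.1] -/
theorem stub_le (_hF : lan2013_siegelFineModuliScheme) (_hg : 0 < g) (_hδ : IsPolarizationType δ) (_hN : 3 ≤ N)
    (𝓜 : SiegelFineModuliScheme g N δ)
    (p : Spec (CommRingCat.of ℂ) ⟶ (MC 𝓜).left) (_hp : IsSection 𝓜 p) :
    tdim 𝓜 (pt 𝓜 p) ≤ g * (g + 1) / 2 :=
  stub_le_of_P4piece (stub_P4piece _hF) _hF _hg _hδ _hN 𝓜 p _hp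

/-- **`stub_ge` — v1 :121 TEXT VERBATIM, now a THEOREM** over `stub_noThinPiece` + `stub_P4piece`.
[cite: Mattila1995, Thm. 7.5] [cite: MumfordFogartyKirwan1994, Appendix to Ch. 7 §A (p. 235)] -/
theorem stub_ge (_hF : lan2013_siegelFineModuliScheme) (_hg : 0 < g) (_hδ : IsPolarizationType δ) (_hN : 3 ≤ N)
    (𝓜 : SiegelFineModuliScheme g N δ)
    (p : Spec (CommRingCat.of ℂ) ⟶ (MC 𝓜).left) (_hp : IsSection 𝓜 p) :
    g * (g + 1) / 2 ≤ tdim 𝓜 (pt 𝓜 p) :=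
  stub_ge_of_noThinPiece stub_noThinPiece (stub_P4piece _hF) _hF _hg _hδ _hN 𝓜 p _hp

/-- The closed-point tangent count of `𝓜_ℂ` from the stubs (v1 §3 text). -/
theorem tdim_eq_of_stubs (hF : lan2013_siegelFineModuliScheme) (hg : 0 < g) (hδ : IsPolarizationType δ) (hN : 3 ≤ N)
    (𝓜 : SiegelFineModuliScheme g N δ) (hS : Smooth (MC 𝓜).hom) :
    ∀ x : (MC 𝓜).left, IsClosed ({x} : Set (MC 𝓜).left) → tdim 𝓜 x = g * (g + 1) / 2 := by
  intro x hx
  haveI : Smooth (MC 𝓜).hom := hS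
  haveI : LocallyOfFiniteType (MC 𝓜).hom := inferInstance
  obtain ⟨p, hp, rfl⟩ := exists_section_of_isClosed 𝓜 x hx
  exact le_antisymm (stub_le hF hg hδ hN 𝓜 p hp) (stub_ge hF hg hδ hN 𝓜 p hp)

/-- EQUIDIM for every carrier, from (F) and the stubs (v1 §3 text; ★ E6 over `ℂ` ∘ ★ field descent).
[cite: GortzWedhorn2020, Prop. 6.15 (1), Lemma 6.26] [cite: GortzWedhorn2023, Thm. 27.301 p. 733] -/
theorem smoothOfRelativeDimension_of_F (hF : lan2013_siegelFineModuliScheme) (hg : 0 < g)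
    (hδ : IsPolarizationType δ) (hN : 3 ≤ N) (𝓜 : SiegelFineModuliScheme g N δ) :
    SmoothOfRelativeDimension (g * (g + 1) / 2) 𝓜.M.hom := by
  haveI := smooth_MC_of_F hF hg hδ hN 𝓜
  haveI : SmoothOfRelativeDimension (g * (g + 1) / 2) (MC 𝓜).hom :=
    Literature.AlgebraicGeometry.Dimension.smoothOfRelativeDimension_of_forall_isClosed_finrank_cotangentSpace_eq
      (MC 𝓜).hom _ (tdim_eq_of_stubs hF hg hδ hN 𝓜 inferInstance)
  exact Literature.AlgebraicGeometry.Limits.smoothOfRelativeDimension_hom_of_baseChangeHom_obj (algebraMap ℚ ℂ) _ 𝓜.M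

/-- **HEAD: (F) ⇒ (F′)** (v1 head text verbatim; (F′) = ★ p737414 BY IMPORT) — REAL glue over `stub_le` / `stub_ge` only,
i.e. modulo EXACTLY {`stub_quotientTriples₈`} since v1.4a (v1.3: {`stub_quotientMaps`}; v1.1: {`stub_P4piece`, `stub_noThinPiece`}). [cite: GortzWedhorn2023, Thm. 27.301 p. 733]
[cite: Lan2013PELCompactifications, Thm. 1.4.1.11 p. 91] -/
theorem relDim_of_F (hF : lan2013_siegelFineModuliScheme) : lan2013_siegelFineModuliScheme_relDim := by
  intro g N δ hg hδ hN
  obtain ⟨𝓜, hs, hq, hX⟩ := hF g N δ hg hδ hN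
  exact ⟨𝓜, hs, hq, hX, smoothOfRelativeDimension_of_F hF hg hδ hN 𝓜⟩

example (hF : lan2013_siegelFineModuliScheme) : lan2013_siegelFineModuliScheme_relDim := relDim_of_F hF

/-- **THE hDel JUNCTION OF THE E-ROAD — `(F)` AS PRINTED + {G-AN1, `NoThinPiece`} ⇒ hDel** (D-0175 (A4)(i)): ★ `HDel_of_F_U`
fed by (F) and (U) := ★ p737802 `UOfF.U_of_relDim_F (relDim_of_F hF)`.  Concludes the crux decl
`Summit.HodgeConjecture.HodgeConjecture.Theses.HCCMUnconditional.HDel` BY NAME with the printed citation (F) as its one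
hypothesis. [cite: Lan2013PELCompactifications, Thm. 1.4.1.11 p. 91, Cor. 7.2.3.9–7.2.3.10] [cite: Deligne1982Hodge, Thm. 2.11] -/
theorem HDel_of_E (hF : lan2013_siegelFineModuliScheme) :
    Summit.HodgeConjecture.HodgeConjecture.Theses.HCCMUnconditional.HDel :=
  Summit.HodgeConjecture.HodgeConjecture.Theorems.HDel_of_F_U hF
    (Summit.HodgeConjecture.HodgeConjecture.Theorems.UOfF.U_of_relDim_F (relDim_of_F hF))

end Literature.AlgebraicGeometry.ModuliOfAbelianVarieties.EquidimOfF

end
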